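import Summits.QuantumFields.BalabanUV.T4Continuum.Support.ShellMeasureWilsonStraddle
import Summits.QuantumFields.BalabanUV.T4Continuum.Support.ShellMeasureWilsonExterior

/-!
# `T4Continuum.ShellMeasureWilsonLevelZero` — (M1)₀ for the CO-TESTED LEVEL-0 SLOT LAW of `G = SU(2)`: exterior
# factor FREE (`ShellMeasureWilsonExterior`), interior co-tests FREE and straddling co-tests DROPPED under the DISPLAYED
# mass ratio (`ShellMeasureWilsonStraddle`) — the assembled level-0 face of (LR)₀ + (MR)₀
# (cell `pub-balaban`, sub-cell `t4`, spine estimate NE7c (node U5b); ROUND-2 crew `t4-ne7c-formalise-*`, leaf prover 03,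
# row S2 of the crew claim table `t4/b2b-balaban-t4-ne7c-p1/LEAVES-NE7c-P1.md`, third file; ADDITIVE — imports the
# row's two files (p208215, `ShellMeasureWilsonExterior`) only; 0 `def`, 0 sorry; consumer: road P1's level-0 face
# of END-I `ShellMeasureRootComposition.shellWeightBound_of_slotAC` (binder `hacX` at level 0) / the seam S13 / the
# push S12, trigger c6)

HONEST FRAMING.  Finite four-torus programme, rung (B)+1 only — NOT infinite volume, NOT a mass gap, NOT the Clay
problem, NOT summit progress; (B), `BetaPertHyp`, (B^μ) not consumed.  NE7c = `T4IndicatorShell.ShellWeightBound` is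
NOT PRINTED in [Balaban 1983–89] and NOT PROVED; «NE7c ⇐ the named binders» (trigger c3); (M1)₀ realized ≠ NE7c;
(M1) for Bałaban's inductively defined effective measures is NOT PRINTED (GAPS G-ne7cp1-1), asserted by nobody.
WHAT THE LEVEL-0 SLOT LAW IS (reading (R) of B14 (2.17)–(2.18) at `k = 0`, the slot's OWN indicator removed): product
Haar `dU` on the cell's `SU(2)` configuration space tilted by «every OTHER cube's small-field test that passes in the
term» × «the Wilson weight `e^{−β Σ_p (1 − reTr U(∂p))}` of B12 (0.2)» (× any further event `E` the term carries); the
slot's tested variable is the verbatim classifier `max_{p∈P_u} dist1 U(∂p)`.  Relative to the slot's box `[lo, hi]`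
and chart bonds `Λ` (box bonds off the axial comb) the factors sort into: (a) `Λ`-BLIND ones — tests on regions
`Q_ext` and Wilson plaquettes `P_ext` none of whose bonds lies in `Λ` — FREE (`ShellMeasureWilsonExterior`, section
constants); (b) INTERIOR parts `Q_i ∩ box` of the tests meeting the box — FREE on the threshold shell given the cover
`boxPlaqs ⊆ P_u ∪ ⋃_i Q_i` and `θ ≤ σ` (`ShellMeasureWilsonStraddle` §1/§2); (c) the STRADDLING remainders `Q_i \ box`
(and `E`) — DROPPED by domination under THE ONE DISPLAYED ESTIMATE BINDER of (MR)₀, the mass ratio `M` of the event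
«all remainders pass, and `E`» under the box-windowed law (`hM`; `M = 2` from the union-bound data «`#I` tests, each
fails with relative mass `≤ q`, `#I·q ≤ 1/2`», B16 (1.89) KIND — NOT proved here, trigger c2: a binder, no
`def … : Prop`).  0 sorry, 0 citations.  HONEST DEPENDENCY (cell): continuum YM on T⁴ ⇐ BetaPertH ∧ nine spine
estimates (0/9 proved); BetaPertH ⇐ (D1) ∧ (D4) ∧ CAP+tail; G-an2-4 gates asym, D1 and NE2/3/4.

WHAT IS PROVED (all [folklore]).  §1 `slotAntiConcentration_wilson_su2_levelZero` — row S1's hypotheses + `θ ≤ σ` +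
an abstract admissible exterior factor `G` + the cover + `hM` ⟹ (M1)₀ for `(1[⋂_i Q_i σ-small ∩ E]·G·e^{−β Σ_{P_w}}) dU`
with constant `2(n + β·#P_w·8S(8+32S))/(1−δ)·M`; `…_levelZero_two` (`M = 2`).  §2 `slotAntiConcentration_wilson_su2_slotLaw`
— the same with the CONCRETE exterior factor `1[Q_ext η-small]·e^{−β Σ_{P_ext}}` (`Q_ext`, `P_ext` avoiding `Λ`,
`P_ext` disjoint from `P_w`), the two Wilson weights MERGED into `e^{−β Σ_{p ∈ P_ext ∪ P_w}}` and the tests into one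
event, the mass ratio displayed for the box-windowed full law `(1[box σ-small ∩ Q_ext η-small]·e^{−β Σ_{P_ext ∪ P_w}}) dU`.
§3 (v2) `slotAntiConcentration_wilson_su2_pure` — the PURE Wilson law `e^{−β Σ_{P_ext ∪ P_w}} dU` (resummed reading of (R), row
S17: no co-test survives) with `↑P_u = boxPlaqs`: (M1)₀ with row S1's constant and NO mass-ratio binder (M = 1).

WHAT THIS DOES NOT DO.  `M`/`q` NOT proved (the (MR)₀ estimate); large-field complements `1 − χ` meeting the box only
inside `E`; the quadratic-in-`S` constant; anything at `j ≥ 1`; NE7c NOT proved; 0/9 spine.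
-/

noncomputable section

open Set Function MeasureTheory

namespace Summit.QuantumFields.BalabanUV.T4Continuum.ShellMeasureWilsonLevelZero

open scoped ENNReal
open Literature.MathematicalPhysics.QuantumFieldTheory.Balaban1983to89
open GaugeField (GaugeInvariant)
open T4ShellMeasure (SlotAntiConcentration)
open T4CubeChartGnomonic (SU2)
open T4AxialGaugeFixing (combBonds measurableSet_plaqSmallOn)
open T4AxialGaugeSmallField (boxPlaqs boxBonds)
open ShellMeasureWilsonRealizedSU2 (wilsonU measurable_wilsonSum wilsonSum_nonneg)
open ShellMeasureWilsonGaugeInvariant (boxTest giF giF_le_one)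
open ShellMeasureWilsonStraddle (slotAntiConcentration_coTests_of_boxTest massRatio_two_of_unionBound)
open ShellMeasureWilsonExterior (slotAntiConcentration_wilson_su2_exterior exteriorFactor_admissible)

variable {P : Params} {j : ℕ} [DecidableEq (PBond P j)]

/-! ## §1 The co-tested level-0 slot law with an abstract free exterior factor -/

section Abstract

/-- **(M1)₀ FOR THE CO-TESTED LEVEL-0 SLOT LAW WITH A FREE EXTERIOR FACTOR.**
`ShellMeasureWilsonExterior.slotAntiConcentration_wilson_su2_exterior` ∘
`ShellMeasureWilsonStraddle.slotAntiConcentration_coTests_of_boxTest`: row S1's hypotheses (non-wrapping box, chart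
bonds `Λ` = box bonds off the axial comb, window `0 < S ≤ 1/8`, reach `(d−1)·m·σ ≤ 2S/π`, `∅ ≠ P_u ⊆ boxPlaqs`, `P_w`,
`β ≥ 0`, `θ > 0`, `0 ≤ δ < 1`, `0 ≤ ρ ≤ (1−δ)/2`, (SM)₀), the slot threshold `θ ≤ σ`, a measurable gauge-invariant
`Λ`-blind factor `G ≤ 1` (FREE), finitely many co-tests `1[Q_i σ-small]` (interior parts free by the COVER
`boxPlaqs ⊆ P_u ∪ ⋃_i Q_i`, remainders `Q_i \ box` DROPPED with any measurable event `E`) and THE DISPLAYED MASS-RATIO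
BINDER `hM` for the law `(G·giF) dU` ⟹ (M1)₀ for `(1[⋂_i Q_i σ-small ∩ E] · G · e^{−β Σ_{p∈P_w}(1 − reTr U(∂p))}) dU`
and `max_{p∈P_u} dist1 U(∂p)`, constant `2(n + β·#P_w·8S(8+32S))/(1−δ) · M`.  `M` NOT proved. [folklore] -/
theorem slotAntiConcentration_wilson_su2_levelZero
    {lo hi : Fin P.d → ℤ} {m : ℕ} (hN : ∀ κ, hi κ - lo κ < P.sitesPerDir j) (hm : ∀ κ, hi κ ≤ lo κ + m)
    (Λ : Finset (PBond P j)) (hΛbox : ∀ b ∈ Λ, b ∈ boxBonds lo hi)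
    (hΛcomb : Disjoint Λ (combBonds lo hi))
    (hcov : ∀ b ∈ boxBonds lo hi, b ∉ Λ → b ∈ (combBonds lo hi : Finset (PBond P j)))
    {n : ℕ} (e : ↥Λ × Fin 3 ≃ Fin n)
    {S σ : ℝ} (hS : 0 < S) (hS8 : S ≤ 1 / 8) (hSπ : 3 * S ^ 2 < Real.pi ^ 2) (hσ : 0 < σ)
    (hrad : ((P.d - 1 : ℕ) : ℝ) * m * σ ≤ 2 * S / Real.pi)
    {Pu : Finset (Plaq P j)} (hPu : Pu.Nonempty) (hPubox : ∀ p ∈ Pu, p ∈ boxPlaqs lo hi)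
    (Pw : Finset (Plaq P j)) {β θ δ ρ : ℝ} (hβ : 0 ≤ β) (hθ : 0 < θ) (hθσ : θ ≤ σ) (hδ0 : 0 ≤ δ) (hδ1 : δ < 1)
    (hρ0 : 0 ≤ ρ) (hρ : ρ ≤ (1 - δ) / 2) (hSM : 4 * (8 * S) ^ 2 * Real.exp (2 * (8 * S)) ≤ δ * θ)
    {Gx : GaugeField P j SU2 → ℝ≥0∞} (hGm : Measurable Gx) (hGi : GaugeInvariant Gx)
    (hGb : ∀ U y, Gx (updateFinset U Λ y) = Gx U) (hG1 : ∀ U, Gx U ≤ 1)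
    {κ : Type*} (I : Finset κ) (Q : κ → Set (Plaq P j))
    (hcovQ : boxPlaqs lo hi ⊆ (↑Pu : Set (Plaq P j)) ∪ ⋃ i ∈ I, Q i)
    {E : Set (GaugeField P j SU2)} (hE : MeasurableSet E) {M : ℝ}
    (hM : (fieldMeasure P j SU2).withDensity (fun U => Gx U * giF lo hi σ β Pw U) univ ≤
      ENNReal.ofReal M * (fieldMeasure P j SU2).withDensity (fun U => Gx U * giF lo hi σ β Pw U)
        ((⋂ i ∈ I, {U | PlaqSmallOn (Q i \ boxPlaqs lo hi) σ U}) ∩ E)) :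
    SlotAntiConcentration
      ((fieldMeasure P j SU2).withDensity fun U =>
        ((⋂ i ∈ I, {U | PlaqSmallOn (Q i) σ U}) ∩ E).indicator 1 U *
          (Gx U * ENNReal.ofReal (Real.exp (-(β * ∑ p ∈ Pw, (1 - reTr (GaugeField.plaqHol U p)))))))
      (wilsonU hPu) θ ρ (2 * ((n : ℝ) + β * ∑ _p ∈ Pw, (8 * S) * (8 + 4 * (8 * S))) / (1 - δ) * M) := by
  have hSMσ : 4 * (8 * S) ^ 2 * Real.exp (2 * (8 * S)) ≤ δ * σ :=
    hSM.trans (mul_le_mul_of_nonneg_left hθσ hδ0)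
  have h0 := slotAntiConcentration_wilson_su2_exterior hN hm Λ hΛbox hΛcomb hcov e hS hS8 hSπ hσ hrad hPu hPubox Pw hβ
    hθ hδ0 hδ1 hρ0 hρ hSM hSMσ hGm hGi hGb hG1
  -- `G · giF = 1[box] · (G · Wilson)`
  have hform : (fun U => Gx U * giF lo hi σ β Pw U) = fun U => (boxTest lo hi σ).indicator 1 U *
      (Gx U * ENNReal.ofReal (Real.exp (-(β * ∑ p ∈ Pw, (1 - reTr (GaugeField.plaqHol U p)))))) := by
    funext U; unfold giF; ring
  rw [hform] at h0 hM
  have hD : 0 ≤ 2 * ((n : ℝ) + β * ∑ _p ∈ Pw, (8 * S) * (8 + 4 * (8 * S))) / (1 - δ) := by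
    have h1δ : 0 < 1 - δ := by linarith
    have hBf : 0 ≤ β * ∑ _p ∈ Pw, (8 * S) * (8 + 4 * (8 * S)) :=
      mul_nonneg hβ (Finset.sum_nonneg fun p _ => by positivity)
    positivity
  have hW : Measurable fun U : GaugeField P j SU2 =>
      Gx U * ENNReal.ofReal (Real.exp (-(β * ∑ p ∈ Pw, (1 - reTr (GaugeField.plaqHol U p))))) :=
    hGm.mul (ENNReal.measurable_ofReal.comp
      (Real.measurable_exp.comp ((measurable_const.mul (measurable_wilsonSum Pw))).neg))
  exact slotAntiConcentration_coTests_of_boxTest hW hPu h0 hD hρ0 hθσ I Q hcovQ hE hM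

/-- **THE SAME WITH THE MASS RATIO PLACED (`M = 2`) BY THE UNION BOUND**: no extra event; each straddling remainder
`Q_i \ box` FAILS under the law `(G·giF) dU` with relative mass `≤ q` (the small-field dominance READING, B16 (1.89)
KIND — displayed, NOT proved) and `#I·q ≤ 1/2`. [folklore] -/
theorem slotAntiConcentration_wilson_su2_levelZero_two
    {lo hi : Fin P.d → ℤ} {m : ℕ} (hN : ∀ κ, hi κ - lo κ < P.sitesPerDir j) (hm : ∀ κ, hi κ ≤ lo κ + m)
    (Λ : Finset (PBond P j)) (hΛbox : ∀ b ∈ Λ, b ∈ boxBonds lo hi)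
    (hΛcomb : Disjoint Λ (combBonds lo hi))
    (hcov : ∀ b ∈ boxBonds lo hi, b ∉ Λ → b ∈ (combBonds lo hi : Finset (PBond P j)))
    {n : ℕ} (e : ↥Λ × Fin 3 ≃ Fin n)
    {S σ : ℝ} (hS : 0 < S) (hS8 : S ≤ 1 / 8) (hSπ : 3 * S ^ 2 < Real.pi ^ 2) (hσ : 0 < σ)
    (hrad : ((P.d - 1 : ℕ) : ℝ) * m * σ ≤ 2 * S / Real.pi)
    {Pu : Finset (Plaq P j)} (hPu : Pu.Nonempty) (hPubox : ∀ p ∈ Pu, p ∈ boxPlaqs lo hi)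
    (Pw : Finset (Plaq P j)) {β θ δ ρ : ℝ} (hβ : 0 ≤ β) (hθ : 0 < θ) (hθσ : θ ≤ σ) (hδ0 : 0 ≤ δ) (hδ1 : δ < 1)
    (hρ0 : 0 ≤ ρ) (hρ : ρ ≤ (1 - δ) / 2) (hSM : 4 * (8 * S) ^ 2 * Real.exp (2 * (8 * S)) ≤ δ * θ)
    {Gx : GaugeField P j SU2 → ℝ≥0∞} (hGm : Measurable Gx) (hGi : GaugeInvariant Gx)
    (hGb : ∀ U y, Gx (updateFinset U Λ y) = Gx U) (hG1 : ∀ U, Gx U ≤ 1)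
    {κ : Type*} (I : Finset κ) (Q : κ → Set (Plaq P j))
    (hcovQ : boxPlaqs lo hi ⊆ (↑Pu : Set (Plaq P j)) ∪ ⋃ i ∈ I, Q i) {q : ℝ}
    (hfail : ∀ i ∈ I, (fieldMeasure P j SU2).withDensity (fun U => Gx U * giF lo hi σ β Pw U)
        {U | PlaqSmallOn (Q i \ boxPlaqs lo hi) σ U}ᶜ ≤
      ENNReal.ofReal q * (fieldMeasure P j SU2).withDensity (fun U => Gx U * giF lo hi σ β Pw U) univ)
    (hmq : (I.card : ℝ) * q ≤ 1 / 2) :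
    SlotAntiConcentration
      ((fieldMeasure P j SU2).withDensity fun U =>
        (⋂ i ∈ I, {U | PlaqSmallOn (Q i) σ U}).indicator 1 U *
          (Gx U * ENNReal.ofReal (Real.exp (-(β * ∑ p ∈ Pw, (1 - reTr (GaugeField.plaqHol U p)))))))
      (wilsonU hPu) θ ρ (2 * ((n : ℝ) + β * ∑ _p ∈ Pw, (8 * S) * (8 + 4 * (8 * S))) / (1 - δ) * 2) := by
  haveI : IsFiniteMeasure ((fieldMeasure P j SU2).withDensity fun U => Gx U * giF lo hi σ β Pw U) :=
    isFiniteMeasure_withDensity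
      ((lintegral_mono fun U => mul_le_one' (hG1 U) (giF_le_one lo hi hβ Pw U)).trans_lt (by simp)).ne
  have hM := massRatio_two_of_unionBound ((fieldMeasure P j SU2).withDensity fun U => Gx U * giF lo hi σ β Pw U) I
    (fun i => {U | PlaqSmallOn (Q i \ boxPlaqs lo hi) σ U}) hfail hmq
  have h := slotAntiConcentration_wilson_su2_levelZero hN hm Λ hΛbox hΛcomb hcov e hS hS8 hSπ hσ hrad hPu hPubox Pw
    hβ hθ hθσ hδ0 hδ1 hρ0 hρ hSM hGm hGi hGb hG1 I Q hcovQ MeasurableSet.univ (M := 2) (by rwa [inter_univ])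
  simpa only [inter_univ] using h

end Abstract

/-! ## §2 The concrete slot law: exterior tests and exterior Wilson plaquettes, merged -/

section Concrete

variable [DecidableEq (Plaq P j)]

omit [DecidableEq (PBond P j)] in
/-- merging two Wilson weights over disjoint plaquette sets. [folklore] -/
theorem wilsonWeight_mul_eq_union {Pe Pw : Finset (Plaq P j)} (h : Disjoint Pe Pw) (β : ℝ) (U : GaugeField P j SU2) :
    ENNReal.ofReal (Real.exp (-(β * ∑ p ∈ Pe, (1 - reTr (GaugeField.plaqHol U p))))) *
        ENNReal.ofReal (Real.exp (-(β * ∑ p ∈ Pw, (1 - reTr (GaugeField.plaqHol U p))))) =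
      ENNReal.ofReal (Real.exp (-(β * ∑ p ∈ Pe ∪ Pw, (1 - reTr (GaugeField.plaqHol U p))))) := by
  rw [← ENNReal.ofReal_mul (Real.exp_pos _).le, ← Real.exp_add, Finset.sum_union h]
  congr 2
  ring

/-- merging two test indicators. [folklore] -/
theorem indicator_one_mul_indicator_one {α : Type*} (s t : Set α) (x : α) :
    s.indicator (1 : α → ℝ≥0∞) x * t.indicator 1 x = (s ∩ t).indicator 1 x := by
  rw [inter_indicator_one]
  rfl

/-- **(M1)₀ FOR THE CONCRETE LEVEL-0 SLOT LAW.**  Data as in §1, plus: an exterior-only test region `Q_ext` (threshold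
`η`) and exterior Wilson plaquettes `P_ext`, both AVOIDING `Λ` (no bond of their plaquettes in `Λ`), `P_ext` disjoint
from `P_w`.  THE DISPLAYED MASS-RATIO BINDER `hM` is stated for the box-windowed full law
`(1[box σ-small ∩ Q_ext η-small] · e^{−β Σ_{p∈P_ext ∪ P_w}(1 − reTr U(∂p))}) dU` and the dropped event «all straddling
remainders `Q_i \ box` σ-small, and `E`».  CONCLUSION: (M1)₀ for THE SLOT LAW
`(1[(⋂_i Q_i σ-small) ∩ Q_ext η-small ∩ E] · e^{−β Σ_{p∈P_ext ∪ P_w}(1 − reTr U(∂p))}) dU` and the verbatim classifier,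
constant `2(n + β·#P_w·8S(8+32S))/(1−δ) · M` (only the plaquettes `P_w` meeting the block enter the constant).  `M` is
the (MR)₀ ESTIMATE, NOT proved; NE7c NOT proved. [folklore] -/
theorem slotAntiConcentration_wilson_su2_slotLaw
    {lo hi : Fin P.d → ℤ} {m : ℕ} (hN : ∀ κ, hi κ - lo κ < P.sitesPerDir j) (hm : ∀ κ, hi κ ≤ lo κ + m)
    (Λ : Finset (PBond P j)) (hΛbox : ∀ b ∈ Λ, b ∈ boxBonds lo hi)
    (hΛcomb : Disjoint Λ (combBonds lo hi))
    (hcov : ∀ b ∈ boxBonds lo hi, b ∉ Λ → b ∈ (combBonds lo hi : Finset (PBond P j)))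
    {n : ℕ} (e : ↥Λ × Fin 3 ≃ Fin n)
    {S σ : ℝ} (hS : 0 < S) (hS8 : S ≤ 1 / 8) (hSπ : 3 * S ^ 2 < Real.pi ^ 2) (hσ : 0 < σ)
    (hrad : ((P.d - 1 : ℕ) : ℝ) * m * σ ≤ 2 * S / Real.pi)
    {Pu : Finset (Plaq P j)} (hPu : Pu.Nonempty) (hPubox : ∀ p ∈ Pu, p ∈ boxPlaqs lo hi)
    (Pw : Finset (Plaq P j)) {β θ δ ρ : ℝ} (hβ : 0 ≤ β) (hθ : 0 < θ) (hθσ : θ ≤ σ) (hδ0 : 0 ≤ δ) (hδ1 : δ < 1)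
    (hρ0 : 0 ≤ ρ) (hρ : ρ ≤ (1 - δ) / 2) (hSM : 4 * (8 * S) ^ 2 * Real.exp (2 * (8 * S)) ≤ δ * θ)
    {Qext : Set (Plaq P j)} (η : ℝ) {Pext : Finset (Plaq P j)}
    (hQext : ∀ p ∈ Qext, (⟨p.src, p.μ⟩ : PBond P j) ∉ Λ ∧ (⟨p.src.shift p.μ, p.ν⟩ : PBond P j) ∉ Λ ∧
      (⟨p.src.shift p.ν, p.μ⟩ : PBond P j) ∉ Λ ∧ (⟨p.src, p.ν⟩ : PBond P j) ∉ Λ)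
    (hPext : ∀ p ∈ Pext, (⟨p.src, p.μ⟩ : PBond P j) ∉ Λ ∧ (⟨p.src.shift p.μ, p.ν⟩ : PBond P j) ∉ Λ ∧
      (⟨p.src.shift p.ν, p.μ⟩ : PBond P j) ∉ Λ ∧ (⟨p.src, p.ν⟩ : PBond P j) ∉ Λ)
    (hdisj : Disjoint Pext Pw)
    {κ : Type*} (I : Finset κ) (Q : κ → Set (Plaq P j))
    (hcovQ : boxPlaqs lo hi ⊆ (↑Pu : Set (Plaq P j)) ∪ ⋃ i ∈ I, Q i)
    {E : Set (GaugeField P j SU2)} (hE : MeasurableSet E) {M : ℝ}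
    (hM : (fieldMeasure P j SU2).withDensity (fun U => (boxTest lo hi σ ∩ {W | PlaqSmallOn Qext η W}).indicator 1 U *
        ENNReal.ofReal (Real.exp (-(β * ∑ p ∈ Pext ∪ Pw, (1 - reTr (GaugeField.plaqHol U p)))))) univ ≤
      ENNReal.ofReal M * (fieldMeasure P j SU2).withDensity
        (fun U => (boxTest lo hi σ ∩ {W | PlaqSmallOn Qext η W}).indicator 1 U *
          ENNReal.ofReal (Real.exp (-(β * ∑ p ∈ Pext ∪ Pw, (1 - reTr (GaugeField.plaqHol U p))))))
        ((⋂ i ∈ I, {U | PlaqSmallOn (Q i \ boxPlaqs lo hi) σ U}) ∩ E)) :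
    SlotAntiConcentration
      ((fieldMeasure P j SU2).withDensity fun U =>
        (((⋂ i ∈ I, {U | PlaqSmallOn (Q i) σ U}) ∩ {W | PlaqSmallOn Qext η W}) ∩ E).indicator 1 U *
          ENNReal.ofReal (Real.exp (-(β * ∑ p ∈ Pext ∪ Pw, (1 - reTr (GaugeField.plaqHol U p))))))
      (wilsonU hPu) θ ρ (2 * ((n : ℝ) + β * ∑ _p ∈ Pw, (8 * S) * (8 + 4 * (8 * S))) / (1 - δ) * M) := by
  obtain ⟨hGm, hGi, hGb, hG1⟩ := exteriorFactor_admissible Λ hQext hPext η hβ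
  -- the exterior factor times `giF` IS the box-windowed full law
  have hlaw : (fun U : GaugeField P j SU2 => {W : GaugeField P j SU2 | PlaqSmallOn Qext η W}.indicator 1 U *
        ENNReal.ofReal (Real.exp (-(β * ∑ p ∈ Pext, (1 - reTr (GaugeField.plaqHol U p))))) *
          giF lo hi σ β Pw U) =
      fun U => (boxTest lo hi σ ∩ {W | PlaqSmallOn Qext η W}).indicator 1 U *
        ENNReal.ofReal (Real.exp (-(β * ∑ p ∈ Pext ∪ Pw, (1 - reTr (GaugeField.plaqHol U p))))) := by
    funext U
    unfold giF
    rw [← wilsonWeight_mul_eq_union hdisj, ← indicator_one_mul_indicator_one]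
    ring
  rw [← hlaw] at hM
  have h := slotAntiConcentration_wilson_su2_levelZero hN hm Λ hΛbox hΛcomb hcov e hS hS8 hSπ hσ hrad hPu hPubox Pw hβ
    hθ hθσ hδ0 hδ1 hρ0 hρ hSM hGm hGi hGb hG1 I Q hcovQ hE hM
  -- merge the conclusion's density
  have hdens : (fun U : GaugeField P j SU2 => ((⋂ i ∈ I, {U | PlaqSmallOn (Q i) σ U}) ∩ E).indicator 1 U *
        ({W : GaugeField P j SU2 | PlaqSmallOn Qext η W}.indicator 1 U *
          ENNReal.ofReal (Real.exp (-(β * ∑ p ∈ Pext, (1 - reTr (GaugeField.plaqHol U p))))) *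
            ENNReal.ofReal (Real.exp (-(β * ∑ p ∈ Pw, (1 - reTr (GaugeField.plaqHol U p))))))) =
      fun U => (((⋂ i ∈ I, {U | PlaqSmallOn (Q i) σ U}) ∩ {W | PlaqSmallOn Qext η W}) ∩ E).indicator 1 U *
        ENNReal.ofReal (Real.exp (-(β * ∑ p ∈ Pext ∪ Pw, (1 - reTr (GaugeField.plaqHol U p))))) := by
    funext U
    rw [inter_right_comm, ← indicator_one_mul_indicator_one _ {W | PlaqSmallOn Qext η W},
      ← wilsonWeight_mul_eq_union hdisj]
    ring
  rwa [hdens] at h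

end Concrete

/-! ## §3 (v2) The PURE Wilson law — no co-test, NO mass ratio: the resummed reading (row S17) at level 0 -/

section Pure

variable [DecidableEq (Plaq P j)]

/-- **(M1)₀ FOR THE PURE LEVEL-0 WILSON LAW — BINDER-FREE.**  In the RESUMMED reading of (R) (row S17,
`ShellMeasureRootCompositionPushCubes`: summing the decomposition of unity over all terms, the realized measure of every
level-0 slot is the run's measure ITSELF — no co-test survives), the slot law is the pure Wilson law
`e^{−β Σ_{p ∈ P_ext ∪ P_w}(1 − reTr U(∂p))} dU` (`P_w` the plaquettes charged to the block, `P_ext` the rest, avoiding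
`Λ`).  If the slot's classifier tests EXACTLY the plaquettes of its box (`↑P_u = boxPlaqs lo hi`; B14 (2.17) at
`k = 0`: the cube's test region □∼ IS the box) then §2 applies with NO co-test (`I = ∅`, `Q_ext = ∅`, `E = univ`)
and the mass-ratio binder is the TAUTOLOGY `μ(univ) ≤ 1·μ(univ)`: (M1)₀ holds with row S1's constant
`2(n + β·#P_w·8S(8+32S))/(1−δ)` and NO displayed estimate left — hypotheses = S1's box/chart/window geometry with the
reach condition at the slot threshold `(d−1)·m·θ ≤ 2S/π`, (SM)₀, `β ≥ 0`, `0 ≤ δ < 1`, `0 ≤ ρ ≤ (1−δ)/2`.  This is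
the level-0 MODEL only ((M1) at live levels `j ≥ 1` = END-II's binders SM-L1…L6); NE7c NOT proved. [folklore] -/
theorem slotAntiConcentration_wilson_su2_pure
    {lo hi : Fin P.d → ℤ} {m : ℕ} (hN : ∀ κ, hi κ - lo κ < P.sitesPerDir j) (hm : ∀ κ, hi κ ≤ lo κ + m)
    (Λ : Finset (PBond P j)) (hΛbox : ∀ b ∈ Λ, b ∈ boxBonds lo hi)
    (hΛcomb : Disjoint Λ (combBonds lo hi))
    (hcov : ∀ b ∈ boxBonds lo hi, b ∉ Λ → b ∈ (combBonds lo hi : Finset (PBond P j)))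
    {n : ℕ} (e : ↥Λ × Fin 3 ≃ Fin n)
    {S : ℝ} (hS : 0 < S) (hS8 : S ≤ 1 / 8) (hSπ : 3 * S ^ 2 < Real.pi ^ 2)
    {Pu : Finset (Plaq P j)} (hPu : Pu.Nonempty) (hPubox : (↑Pu : Set (Plaq P j)) = boxPlaqs lo hi)
    (Pw : Finset (Plaq P j)) {Pext : Finset (Plaq P j)}
    (hPext : ∀ p ∈ Pext, (⟨p.src, p.μ⟩ : PBond P j) ∉ Λ ∧ (⟨p.src.shift p.μ, p.ν⟩ : PBond P j) ∉ Λ ∧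
      (⟨p.src.shift p.ν, p.μ⟩ : PBond P j) ∉ Λ ∧ (⟨p.src, p.ν⟩ : PBond P j) ∉ Λ)
    (hdisj : Disjoint Pext Pw) {β θ δ ρ : ℝ} (hβ : 0 ≤ β) (hθ : 0 < θ)
    (hrad : ((P.d - 1 : ℕ) : ℝ) * m * θ ≤ 2 * S / Real.pi) (hδ0 : 0 ≤ δ) (hδ1 : δ < 1)
    (hρ0 : 0 ≤ ρ) (hρ : ρ ≤ (1 - δ) / 2) (hSM : 4 * (8 * S) ^ 2 * Real.exp (2 * (8 * S)) ≤ δ * θ) :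
    SlotAntiConcentration
      ((fieldMeasure P j SU2).withDensity fun U =>
        ENNReal.ofReal (Real.exp (-(β * ∑ p ∈ Pext ∪ Pw, (1 - reTr (GaugeField.plaqHol U p))))))
      (wilsonU hPu) θ ρ (2 * ((n : ℝ) + β * ∑ _p ∈ Pw, (8 * S) * (8 + 4 * (8 * S))) / (1 - δ)) := by
  have hPubox' : ∀ p ∈ Pu, p ∈ boxPlaqs lo hi := fun p hp => hPubox ▸ Finset.mem_coe.2 hp
  have hcovQ : boxPlaqs lo hi ⊆ (↑Pu : Set (Plaq P j)) ∪ ⋃ i ∈ (∅ : Finset Unit), (fun _ => (∅ : Set (Plaq P j))) i :=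
    fun p hp => Or.inl (hPubox ▸ hp)
  have hQext : ∀ p ∈ (∅ : Set (Plaq P j)), (⟨p.src, p.μ⟩ : PBond P j) ∉ Λ ∧
      (⟨p.src.shift p.μ, p.ν⟩ : PBond P j) ∉ Λ ∧ (⟨p.src.shift p.ν, p.μ⟩ : PBond P j) ∉ Λ ∧
      (⟨p.src, p.ν⟩ : PBond P j) ∉ Λ := fun p hp => absurd hp (Set.notMem_empty p)
  -- the co-test events are all of space
  have hext : {W : GaugeField P j SU2 | PlaqSmallOn (∅ : Set (Plaq P j)) θ W} = univ :=
    Set.eq_univ_of_forall fun W p hp => absurd hp (Set.notMem_empty p)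
  have hint : (⋂ i ∈ (∅ : Finset Unit), {U : GaugeField P j SU2 |
      PlaqSmallOn ((fun _ => (∅ : Set (Plaq P j))) i \ boxPlaqs lo hi) θ U}) = univ := by
    simp
  have hint' : (⋂ i ∈ (∅ : Finset Unit), {U : GaugeField P j SU2 |
      PlaqSmallOn ((fun _ => (∅ : Set (Plaq P j))) i) θ U}) = univ := by
    simp
  have h := slotAntiConcentration_wilson_su2_slotLaw hN hm Λ hΛbox hΛcomb hcov e hS hS8 hSπ hθ hrad hPu hPubox' Pw
    hβ hθ le_rfl hδ0 hδ1 hρ0 hρ hSM θ hQext hPext hdisj (∅ : Finset Unit) (fun _ => (∅ : Set (Plaq P j))) hcovQ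
    MeasurableSet.univ (M := 1) (by rw [hint, univ_inter, ENNReal.ofReal_one, one_mul, hext, inter_univ])
  rw [hint', hext, univ_inter, inter_univ, mul_one] at h
  simpa only [indicator_univ, Pi.one_apply, one_mul] using h

end Pure

end Summit.QuantumFields.BalabanUV.T4Continuum.ShellMeasureWilsonLevelZero
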